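import Summits.Ventures.CertifiedQuantumChemistry.Statement
import HarnessLib

/-!
# Ventures/CertifiedQuantumChemistry — Hamiltonians/HubbardRingTV.lean: the Hubbard-ring test-vector models TV-H

HONEST FRAMING (verbatim): certified bounds for a stated model Hamiltonian in a stated basis; not a
claim about the real molecule beyond that model.

The DAY-1 calibration track S0-H (SCOPING §1 row R0/S0-H, FANOUT row 60) certifies both sides of the
sector ground energy of the one-dimensional Hubbard RING with `L` sites written as an integral file
(FCIDUMP-class test vector "TV-H", zero external data): one-electron integrals `h_pq = −t` on the ring
bonds `q ≡ p ± 1 (mod L)`, two-electron integrals `(pp|pp) = U` (all other `(pq|rs) = 0`), `E_core = 0`.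
As a `Model L` (exact rationals) this is `hubbardRingTV L t U`; the cell's files
`run/shared/lean/pub/pub-qchem/pub-qchem-var/s0h/files/TVH_L{4,6}_N{4,6}_U{1,10,100,1000,10000}.FCIDUMP`
are exactly `hubbardRingTV 4 1 U` / `hubbardRingTV 6 1 U` (h lines `-1.0 p p+1`, `-1.0 1 L`; V lines
`U p p p p`; checked line-by-line by the typer's generator of `Certificates/HubbardRingS0HUpper.lean`).
In operator form `H = −t Σ_{⟨pq⟩,σ} a†_{pσ} a_{qσ} + ½ U Σ_p Σ_{στ} a†_{pσ} a†_{pτ} a_{pτ} a_{pσ}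
= −t Σ_{⟨pq⟩,σ} (a†_{pσ} a_{qσ} + h.c.) + U Σ_p n_{p↑} n_{p↓}`, i.e. the tree's
`hubbardTorus 1 L t U` up to the site relabelling `Fin L ≃ FermionTorus 1 L` (the equality as
matrices is NOT proved here — aside T-06; every S0-H row is stated on `hubbardRingTV` itself, the
object the certificates are about). `L ≥ 3` is intended (for `L ≤ 2` the "ring" degenerates).
-/

namespace Summit.Ventures.CertifiedQuantumChemistry.Hamiltonians

/-- Adjacency of the `L`-ring on `Fin L`: `p ≠ q` and `q ≡ p + 1` or `p ≡ q + 1 (mod L)`. -/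
def ringAdj (L : ℕ) (p q : Fin L) : Prop := p ≠ q ∧ ((p.val + 1) % L = q.val ∨ (q.val + 1) % L = p.val)

/-- Decidability of this rational-slot predicate (by `inferInstanceAs`; lets `decide`/`norm_num` close instances). -/
instance (L : ℕ) (p q : Fin L) : Decidable (ringAdj L p q) :=
  inferInstanceAs (Decidable (p ≠ q ∧ ((p.val + 1) % L = q.val ∨ (q.val + 1) % L = p.val)))

/-- `ringAdj` is symmetric. -/
theorem ringAdj_comm {L : ℕ} {p q : Fin L} : ringAdj L p q ↔ ringAdj L q p := by
  unfold ringAdj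
  constructor <;> rintro ⟨h1, h2⟩ <;> exact ⟨Ne.symm h1, h2.symm⟩

/-- The TV-H model of the `L`-site Hubbard ring with hopping `t` and repulsion `U` as exact-rational
integral data: `h_pq = −t` on ring bonds, `(pp|pp) = U`, everything else `0`, `E_core = 0`. -/
def hubbardRingTV (L : ℕ) (t U : ℚ) : Model L where
  h p q := if ringAdj L p q then -t else 0
  eri p q r s := if p = q ∧ q = r ∧ r = s then U else 0
  ecore := 0

/-- The TV-H model is symmetric (hence its Hamiltonian is Hermitian, `Model.hamiltonian_isHermitian`). -/
theorem hubbardRingTV_isSymmetric (L : ℕ) (t U : ℚ) : (hubbardRingTV L t U).IsSymmetric := by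
  refine ⟨fun p q => ?_, fun p q r s => ?_⟩
  · simp only [hubbardRingTV]
    by_cases h1 : ringAdj L p q
    · rw [if_pos h1, if_pos (ringAdj_comm.1 h1)]
    · rw [if_neg h1, if_neg (fun h2 => h1 (ringAdj_comm.1 h2))]
  · simp only [hubbardRingTV]
    by_cases h1 : p = q ∧ q = r ∧ r = s
    · obtain ⟨rfl, rfl, rfl⟩ := h1
      simp
    · have h2 : ¬ (q = p ∧ p = s ∧ s = r) := fun ⟨a1, a2, a3⟩ =>
        h1 ⟨a1.symm, a1.trans (a2.trans a3), a3.symm⟩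
      rw [if_neg h1, if_neg h2]

/-- The TV-H Hamiltonian is Hermitian. -/
theorem hubbardRingTV_hamiltonian_isHermitian (L : ℕ) (t U : ℚ) :
    (hubbardRingTV L t U).hamiltonian.IsHermitian :=
  Model.hamiltonian_isHermitian (hubbardRingTV_isSymmetric L t U)

end Summit.Ventures.CertifiedQuantumChemistry.Hamiltonians
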